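import Literature.Combinatorics.Sahi2008.Percolation
import Summits.CriticalPhenomena.PercolationContinuityZ3.Theorems.SahiConjecture
import Summits.CriticalPhenomena.PercolationContinuityZ3.Theorems.PercNearOneGluingNoHeavyLowerTailSahiAbsorbedComparable

/-!
# Kahn's Conjecture 5 (= Sahi's `C₃` for product measures) holds on the 'containing' stratum and REDUCES to non-containing triples

Support file (lane `prim-masterthm-p3`, generation 18; `--supports stmt-CriticalPhenomena-4575`).  Pure proofs, no definitions,
no `sorry`, standard axioms.

The tree's obligation `KahnConjecture` asks `E₃(A,B,C) ≥ 0` (`sahiE3 (prodBernoulli p) A B C`) for all increasing events `A, B, C ⊆ 2^ι` and every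
product measure.  From `SahiAbsorbed.sahiE_three_setInd_nonneg_of_inter_subset` (every FKG weight; product weights are FKG,
`isFKGMeasure_bernoulliWeight`) and the dictionary `sahiE_three_ind`:
* `kahn_sahiE3_nonneg_of_inter_subset`: **`E₃(A,B,C) ≥ 0` for every product measure as soon as one of the three increasing events contains the
  intersection of the other two** (in particular whenever two of them are comparable, `kahn_sahiE3_nonneg_of_subset`);
* `kahnConjecture_of_noncontaining`: **`KahnConjecture` follows from its restriction to triples in which no event contains the intersection of
  the other two;**
* `sahiConjecture_three_of_noncontaining` / `sahiConjecture_of_noncontaining`: the same reduction for SAHI'S `C₃` on every finite distributive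
  lattice with an FKG weight, and inductively for `C_{n+2}` given `C_{≤ n+1}`. [this work]
-/

namespace Summit.CriticalPhenomena.PercolationContinuityZ3.Theorems

open Finset Function
open Literature.Combinatorics.Sahi2008 Literature.Probability.LatticeModels
open Literature.Probability.Percolation.DecisionTree (ind)

namespace SahiAbsorbed

section Kahn

open scoped Classical

variable {ι : Type} [Fintype ι]

/-- The `Set`-indicator of the percolation files is the `Finset`-indicator of this lane's files. [this work] -/
theorem ind_eq_setInd_toFinset (A : Set (Set ι)) : ind A = setInd A.toFinset := by
  funext x
  simp [ind, setInd_apply]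

/-- The order-3 family `![ind A, ind B, ind C]` as a `Finset`-indicator family. [this work] -/
theorem vec_ind_eq (A B C : Set (Set ι)) :
    (![ind A, ind B, ind C] : Fin 3 → Set ι → ℝ) = fun k => setInd ((![A.toFinset, B.toFinset, C.toFinset] : Fin 3 → Finset (Set ι)) k) := by
  funext k
  fin_cases k <;> simp [ind_eq_setInd_toFinset]

/-- **Kahn's Conjecture 5 on the containing stratum**: for every product measure on a finite cube and increasing `A, B, C` with one of
them containing the intersection of the other two, `E₃(A,B,C) ≥ 0`. [this work] -/
theorem kahn_sahiE3_nonneg_of_inter_subset (p : ι → unitInterval) (A B C : Set (Set ι)) (hA : IsUpperSet A) (hB : IsUpperSet B)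
    (hC : IsUpperSet C) (j : Fin 3)
    (hj : ∀ ω, (∀ k : Fin 3, k ≠ j → ω ∈ (![A, B, C] : Fin 3 → Set (Set ι)) k) → ω ∈ (![A, B, C] : Fin 3 → Set (Set ι)) j) :
    0 ≤ sahiE3 (prodBernoulli p) A B C := by
  rw [← sahiE_three_ind, vec_ind_eq]
  refine sahiE_three_setInd_nonneg_of_inter_subset (isFKGMeasure_bernoulliWeight p) _ (fun k => ?_) j (fun ω hω => ?_)
  · fin_cases k
    · simpa using hA
    · simpa using hB
    · simpa using hC
  · have h := hj ω (fun k hk => by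
      have := hω k hk
      fin_cases k <;> simpa using this)
    fin_cases j <;> simpa using h

/-- **Two comparable increasing events** (`W_i ⊆ W_j`, `i ≠ j`, among `A, B, C`) ⟹ `E₃(A,B,C) ≥ 0` for every product measure. [this work] -/
theorem kahn_sahiE3_nonneg_of_subset (p : ι → unitInterval) (A B C : Set (Set ι)) (hA : IsUpperSet A) (hB : IsUpperSet B)
    (hC : IsUpperSet C) {i j : Fin 3} (hij : i ≠ j)
    (hsub : (![A, B, C] : Fin 3 → Set (Set ι)) i ⊆ (![A, B, C] : Fin 3 → Set (Set ι)) j) :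
    0 ≤ sahiE3 (prodBernoulli p) A B C :=
  kahn_sahiE3_nonneg_of_inter_subset p A B C hA hB hC j fun _ hω => hsub (hω i hij)

/-- **KAHN'S CONJECTURE REDUCES TO NON-CONTAINING TRIPLES**: it suffices to prove `E₃(A,B,C) ≥ 0` for the increasing triples in which no
event contains the intersection of the other two. [this work] -/
theorem kahnConjecture_of_noncontaining
    (hcore : ∀ (ι : Type) [Fintype ι] (p : ι → unitInterval) (A B C : Set (Set ι)),
      IsUpperSet A → IsUpperSet B → IsUpperSet C →
      (∀ j : Fin 3, ∃ ω, (∀ k : Fin 3, k ≠ j → ω ∈ (![A, B, C] : Fin 3 → Set (Set ι)) k) ∧ ω ∉ (![A, B, C] : Fin 3 → Set (Set ι)) j) →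
      0 ≤ sahiE3 (prodBernoulli p) A B C) :
    KahnConjecture := by
  intro ι _ p A B C hA hB hC
  by_cases h : ∃ j : Fin 3, ∀ ω, (∀ k : Fin 3, k ≠ j → ω ∈ (![A, B, C] : Fin 3 → Set (Set ι)) k) → ω ∈ (![A, B, C] : Fin 3 → Set (Set ι)) j
  · obtain ⟨j, hj⟩ := h
    exact kahn_sahiE3_nonneg_of_inter_subset p A B C hA hB hC j hj
  · push Not at h
    exact hcore ι p A B C hA hB hC h

end Kahn

section SahiThree

/-- **SAHI'S CONJECTURE `C₃` REDUCES TO NON-CONTAINING TRIPLES** (every finite distributive lattice, every FKG weight): it suffices to prove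
`E₃(1_{W_0}, 1_{W_1}, 1_{W_2}) ≥ 0` for the up-set triples in which no member contains the intersection of the other two (the orders `1, 2`
being theorems: nonnegativity and the FKG inequality). [this work] -/
theorem sahiConjecture_three_of_noncontaining
    (hcore : ∀ (α : Type) [DistribLattice α] [Fintype α] [DecidableEq α] (μ : α → ℝ), IsFKGMeasure μ →
      ∀ W : Fin 3 → Finset α, (∀ j, IsUpperSet (W j : Set α)) →
        (∀ j, ∃ x, (∀ k, k ≠ j → x ∈ W k) ∧ x ∉ W j) → 0 ≤ sahiE μ 3 (fun k => setInd (W k))) :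
    SahiConjecture 3 := by
  intro α _ _ μ hμ
  classical
  refine sahiPositive_of_noncontaining (n := 1) hμ.nonneg hμ.sum_eq_one (fun k hk1 hk2 => ?_) (hcore α μ hμ)
  interval_cases k
  · exact sahiPositive_one hμ.nonneg
  · exact sahiPositive_two hμ

/-- **Inductive form at every order**: `C_{n+2}` follows from `C_k` (`k ≤ n+1`) together with positivity on the non-containing up-set families
of size `n+2`, lattice by lattice. [this work] -/
theorem sahiConjecture_of_noncontaining {n : ℕ} (hlow : ∀ k, 1 ≤ k → k ≤ n + 1 → SahiConjecture k)
    (hcore : ∀ (α : Type) [DistribLattice α] [Fintype α] [DecidableEq α] (μ : α → ℝ), IsFKGMeasure μ →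
      ∀ W : Fin (n + 2) → Finset α, (∀ j, IsUpperSet (W j : Set α)) →
        (∀ j, ∃ x, (∀ k, k ≠ j → x ∈ W k) ∧ x ∉ W j) → 0 ≤ sahiE μ (n + 2) (fun k => setInd (W k))) :
    SahiConjecture (n + 2) := by
  intro α _ _ μ hμ
  classical
  exact sahiPositive_of_noncontaining hμ.nonneg hμ.sum_eq_one (fun k hk1 hk2 => hlow k hk1 hk2 α μ hμ) (hcore α μ hμ)

end SahiThree

end SahiAbsorbed

end Summit.CriticalPhenomena.PercolationContinuityZ3.Theorems
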